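import Literature.Barriers.CriticalPhenomena.ScaleCovarianceNotMoebius

/-!
# `InversionUpgradeNormalised` (item stmt-CriticalPhenomena-1982): the six-point witness family (four-point covariance does not propagate, part I)

Negative knowledge about the crux
`Summit.CriticalPhenomena.Ising3DConformalLimit.Theses.HyperoctahedralRP.InversionUpgradeNormalised`
(standing crux disprover, cycle 2, D-0016). By `Negative/AutomaticOrders.crux_iff_evenFromFour` the
crux is the conformal covariance of `S₄, S₆, …` of the pinned Ising₃ limit. Several crux cards make a
FOUR-point statement their first contentful stub (`FourPointOneSided`, `CriticalRobinLaw`,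
`CurrentConnectionInvariance.RatioInversionInvariance`). This file shows MODEL-BLIND that the
four-point identity, even for a non-Gaussian family with every symmetry, positivity of `S₂, S₄`,
the Lebowitz sign and covariance at ALL OTHER orders, does not imply the six-point identity:

* witness `sixFamily Δ`: `S₀ = 1`, `S₂ = ‖x−y‖^{-2Δ}`, `S₄ = Wick − harm` with the COVARIANT
  non-Gaussian connected part `harm = (W₁⁻¹ + W₂⁻¹ + W₃⁻¹)⁻¹` of the three Wick products (each
  point carries weight `2Δ` in every `W_p`, so `harm(ιx) = ∏‖xᵢ‖^{2Δ}·harm(x)`; `0 < harm ≤ W_p`,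
  hence `U₄ = −harm < 0` and `S₄ ≥ W₁ + W₂ ≥ 0`), `S₆ = Wick₆ − (Σᵢⱼ‖xᵢ−xⱼ‖²)^{-3Δ}`, `0` otherwise
  and on coincident configurations;
* this file: the definitions (`W1 W2 W3 harm wick6 sqSum6 bump6 sixFamily config6`) and the
  symmetry / positivity lemmas; part II (`Negative/SixPoint.lean`): the inversion identity at every
  order `n ≠ 6`, its failure at order `6` (`(e, 2e, …, 6e)`: `((120/707)³)^Δ ≠ (720²/210³)^Δ`), and
  the packaged statements `fourPoint_does_not_propagate`, `not_inversionUpgrade_from_low_orders`.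

So for limits of `criticalCorr 3` a four-point theorem closes the crux only together with an
all-orders mechanism; the tree has one on the Gaussian locus ONLY
(`HasPointwiseScalingLimit.eq_pairingSum_of_limitConnectedFour_eq_zero`), and the physical limit has
`U₄ < 0`.
-/

noncomputable section

namespace Summit.CriticalPhenomena.Ising3DConformalLimit.InversionUpgradeNormalisedNegative

open Literature.Probability.LatticeModels Literature.Barriers.CriticalPhenomena
open Set Function EuclideanGeometry ScaleNotMoebius Finset

/-! ## The covariant non-Gaussian four-point connected part `harm` -/

/-- The three Wick products of a four-point configuration. [folklore] -/
def W1 (Δ : ℝ) (x : Fin 4 → EuclideanSpace ℝ (Fin 3)) : ℝ := twoPt Δ (x 0) (x 1) * twoPt Δ (x 2) (x 3)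
/-- Second Wick product. [folklore] -/
def W2 (Δ : ℝ) (x : Fin 4 → EuclideanSpace ℝ (Fin 3)) : ℝ := twoPt Δ (x 0) (x 2) * twoPt Δ (x 1) (x 3)
/-- Third Wick product. [folklore] -/
def W3 (Δ : ℝ) (x : Fin 4 → EuclideanSpace ℝ (Fin 3)) : ℝ := twoPt Δ (x 0) (x 3) * twoPt Δ (x 1) (x 2)

/-- `wick = W₁ + W₂ + W₃`. [folklore] -/
theorem wick_eq (Δ : ℝ) (x : Fin 4 → EuclideanSpace ℝ (Fin 3)) : wick Δ x = W1 Δ x + W2 Δ x + W3 Δ x := rfl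

/-- The harmonic-type combination `harm = (W₁⁻¹ + W₂⁻¹ + W₃⁻¹)⁻¹` of the three Wick products:
a conformally COVARIANT candidate for `-U₄` (each point carries weight `2Δ` in every `W_p`). [folklore] -/
def harm (Δ : ℝ) (x : Fin 4 → EuclideanSpace ℝ (Fin 3)) : ℝ :=
  ((W1 Δ x)⁻¹ + (W2 Δ x)⁻¹ + (W3 Δ x)⁻¹)⁻¹

/-- `W₁ > 0` on non-coincident configurations. [folklore] -/
theorem W1_pos (Δ : ℝ) {x : Fin 4 → EuclideanSpace ℝ (Fin 3)} (hx : Injective x) : 0 < W1 Δ x :=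
  mul_pos (twoPt_pos Δ (hx.ne (by decide))) (twoPt_pos Δ (hx.ne (by decide)))
/-- `W₂ > 0` on non-coincident configurations. [folklore] -/
theorem W2_pos (Δ : ℝ) {x : Fin 4 → EuclideanSpace ℝ (Fin 3)} (hx : Injective x) : 0 < W2 Δ x :=
  mul_pos (twoPt_pos Δ (hx.ne (by decide))) (twoPt_pos Δ (hx.ne (by decide)))
/-- `W₃ > 0` on non-coincident configurations. [folklore] -/
theorem W3_pos (Δ : ℝ) {x : Fin 4 → EuclideanSpace ℝ (Fin 3)} (hx : Injective x) : 0 < W3 Δ x :=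
  mul_pos (twoPt_pos Δ (hx.ne (by decide))) (twoPt_pos Δ (hx.ne (by decide)))

/-- `harm > 0` on non-coincident configurations. [folklore] -/
theorem harm_pos (Δ : ℝ) {x : Fin 4 → EuclideanSpace ℝ (Fin 3)} (hx : Injective x) : 0 < harm Δ x := by
  have h1 := W1_pos Δ hx; have h2 := W2_pos Δ hx; have h3 := W3_pos Δ hx
  unfold harm
  positivity

/-- `harm ≤ W₁` (and likewise `≤ W₂, W₃`). [folklore] -/
theorem harm_le_W1 (Δ : ℝ) {x : Fin 4 → EuclideanSpace ℝ (Fin 3)} (hx : Injective x) : harm Δ x ≤ W1 Δ x := by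
  have h1 := W1_pos Δ hx; have h2 := W2_pos Δ hx; have h3 := W3_pos Δ hx
  unfold harm
  rw [inv_le_comm₀ (by positivity) h1]
  have : 0 ≤ (W2 Δ x)⁻¹ + (W3 Δ x)⁻¹ := by positivity
  linarith

/-- `harm ≤ W₂`. [folklore] -/
theorem harm_le_W2 (Δ : ℝ) {x : Fin 4 → EuclideanSpace ℝ (Fin 3)} (hx : Injective x) : harm Δ x ≤ W2 Δ x := by
  have h1 := W1_pos Δ hx; have h2 := W2_pos Δ hx; have h3 := W3_pos Δ hx
  unfold harm
  rw [inv_le_comm₀ (by positivity) h2]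
  have : 0 ≤ (W1 Δ x)⁻¹ + (W3 Δ x)⁻¹ := by positivity
  linarith

/-- `harm ≤ W₃`. [folklore] -/
theorem harm_le_W3 (Δ : ℝ) {x : Fin 4 → EuclideanSpace ℝ (Fin 3)} (hx : Injective x) : harm Δ x ≤ W3 Δ x := by
  have h1 := W1_pos Δ hx; have h2 := W2_pos Δ hx; have h3 := W3_pos Δ hx
  unfold harm
  rw [inv_le_comm₀ (by positivity) h3]
  have : 0 ≤ (W1 Δ x)⁻¹ + (W2 Δ x)⁻¹ := by positivity
  linarith

/-- Each Wick product is inversion covariant with the full factor `∏ ‖xᵢ‖^{2Δ}`. [folklore] -/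
theorem W1_inversion (Δ : ℝ) {x : Fin 4 → EuclideanSpace ℝ (Fin 3)} (hx : ∀ i, x i ≠ 0) :
    W1 Δ (fun i => inversion 0 1 (x i)) = (∏ i, ‖x i‖ ^ (2 * Δ)) * W1 Δ x := by
  simp only [W1, twoPt_inversion Δ (hx _) (hx _), Fin.prod_univ_four]; ring
/-- `W₂` is inversion covariant. [folklore] -/
theorem W2_inversion (Δ : ℝ) {x : Fin 4 → EuclideanSpace ℝ (Fin 3)} (hx : ∀ i, x i ≠ 0) :
    W2 Δ (fun i => inversion 0 1 (x i)) = (∏ i, ‖x i‖ ^ (2 * Δ)) * W2 Δ x := by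
  simp only [W2, twoPt_inversion Δ (hx _) (hx _), Fin.prod_univ_four]; ring
/-- `W₃` is inversion covariant. [folklore] -/
theorem W3_inversion (Δ : ℝ) {x : Fin 4 → EuclideanSpace ℝ (Fin 3)} (hx : ∀ i, x i ≠ 0) :
    W3 Δ (fun i => inversion 0 1 (x i)) = (∏ i, ‖x i‖ ^ (2 * Δ)) * W3 Δ x := by
  simp only [W3, twoPt_inversion Δ (hx _) (hx _), Fin.prod_univ_four]; ring

/-- The Kelvin factor `∏ ‖xᵢ‖^{2Δ}` is positive off the origin. [folklore] -/
theorem prod_norm_rpow_pos (Δ : ℝ) {n : ℕ} {x : Fin n → EuclideanSpace ℝ (Fin 3)} (hx : ∀ i, x i ≠ 0) :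
    0 < ∏ i, ‖x i‖ ^ (2 * Δ) :=
  Finset.prod_pos fun i _ => Real.rpow_pos_of_pos (norm_pos_iff.2 (hx i)) _

/-- `harm` is inversion covariant: `harm(ιx) = (∏‖xᵢ‖^{2Δ}) harm(x)`. [folklore] -/
theorem harm_inversion (Δ : ℝ) {x : Fin 4 → EuclideanSpace ℝ (Fin 3)} (hx : ∀ i, x i ≠ 0)
    (hinj : Injective x) :
    harm Δ (fun i => inversion 0 1 (x i)) = (∏ i, ‖x i‖ ^ (2 * Δ)) * harm Δ x := by
  have hF := prod_norm_rpow_pos Δ hx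
  have h1 := W1_pos Δ hinj; have h2 := W2_pos Δ hinj; have h3 := W3_pos Δ hinj
  unfold harm
  rw [W1_inversion Δ hx, W2_inversion Δ hx, W3_inversion Δ hx]
  field_simp

/-- `W_p` scale as `c^{-4Δ}`. [folklore] -/
theorem W1_smul (Δ : ℝ) {c : ℝ} (hc : 0 < c) (x : Fin 4 → EuclideanSpace ℝ (Fin 3)) :
    W1 Δ (fun i => c • x i) = c ^ (-(2 * Δ)) * c ^ (-(2 * Δ)) * W1 Δ x := by
  simp only [W1, twoPt_smul Δ hc]; ring
/-- `W₂` scales as `c^{-4Δ}`. [folklore] -/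
theorem W2_smul (Δ : ℝ) {c : ℝ} (hc : 0 < c) (x : Fin 4 → EuclideanSpace ℝ (Fin 3)) :
    W2 Δ (fun i => c • x i) = c ^ (-(2 * Δ)) * c ^ (-(2 * Δ)) * W2 Δ x := by
  simp only [W2, twoPt_smul Δ hc]; ring
/-- `W₃` scales as `c^{-4Δ}`. [folklore] -/
theorem W3_smul (Δ : ℝ) {c : ℝ} (hc : 0 < c) (x : Fin 4 → EuclideanSpace ℝ (Fin 3)) :
    W3 Δ (fun i => c • x i) = c ^ (-(2 * Δ)) * c ^ (-(2 * Δ)) * W3 Δ x := by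
  simp only [W3, twoPt_smul Δ hc]; ring

/-- `harm` scales as `c^{-4Δ}`. [folklore] -/
theorem harm_smul (Δ : ℝ) {c : ℝ} (hc : 0 < c) {x : Fin 4 → EuclideanSpace ℝ (Fin 3)} (hinj : Injective x) :
    harm Δ (fun i => c • x i) = c ^ (-(2 * Δ)) * c ^ (-(2 * Δ)) * harm Δ x := by
  have h1 := W1_pos Δ hinj; have h2 := W2_pos Δ hinj; have h3 := W3_pos Δ hinj
  have hc' : 0 < c ^ (-(2 * Δ)) := Real.rpow_pos_of_pos hc _
  unfold harm
  rw [W1_smul Δ hc, W2_smul Δ hc, W3_smul Δ hc]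
  field_simp

/-- `harm` is translation invariant. [folklore] -/
theorem harm_add (Δ : ℝ) (v : EuclideanSpace ℝ (Fin 3)) (x : Fin 4 → EuclideanSpace ℝ (Fin 3)) :
    harm Δ (fun i => x i + v) = harm Δ x := by
  simp only [harm, W1, W2, W3, twoPt_add]

/-- `harm` is `O(3)` invariant. [folklore] -/
theorem harm_map (Δ : ℝ) (R : EuclideanSpace ℝ (Fin 3) ≃ₗᵢ[ℝ] EuclideanSpace ℝ (Fin 3))
    (x : Fin 4 → EuclideanSpace ℝ (Fin 3)) : harm Δ (fun i => R (x i)) = harm Δ x := by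
  simp only [harm, W1, W2, W3, twoPt_map]

/-! ## Six points: Wick sum and bump -/

/-- The Gaussian six-point function: sum over the 15 pairings. [folklore] -/
def wick6 (Δ : ℝ) (x : Fin 6 → EuclideanSpace ℝ (Fin 3)) : ℝ :=
  twoPt Δ (x 0) (x 1) * twoPt Δ (x 2) (x 3) * twoPt Δ (x 4) (x 5) +
  twoPt Δ (x 0) (x 1) * twoPt Δ (x 2) (x 4) * twoPt Δ (x 3) (x 5) +
  twoPt Δ (x 0) (x 1) * twoPt Δ (x 2) (x 5) * twoPt Δ (x 3) (x 4) +
  twoPt Δ (x 0) (x 2) * twoPt Δ (x 1) (x 3) * twoPt Δ (x 4) (x 5) +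
  twoPt Δ (x 0) (x 2) * twoPt Δ (x 1) (x 4) * twoPt Δ (x 3) (x 5) +
  twoPt Δ (x 0) (x 2) * twoPt Δ (x 1) (x 5) * twoPt Δ (x 3) (x 4) +
  twoPt Δ (x 0) (x 3) * twoPt Δ (x 1) (x 2) * twoPt Δ (x 4) (x 5) +
  twoPt Δ (x 0) (x 3) * twoPt Δ (x 1) (x 4) * twoPt Δ (x 2) (x 5) +
  twoPt Δ (x 0) (x 3) * twoPt Δ (x 1) (x 5) * twoPt Δ (x 2) (x 4) +
  twoPt Δ (x 0) (x 4) * twoPt Δ (x 1) (x 2) * twoPt Δ (x 3) (x 5) +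
  twoPt Δ (x 0) (x 4) * twoPt Δ (x 1) (x 3) * twoPt Δ (x 2) (x 5) +
  twoPt Δ (x 0) (x 4) * twoPt Δ (x 1) (x 5) * twoPt Δ (x 2) (x 3) +
  twoPt Δ (x 0) (x 5) * twoPt Δ (x 1) (x 2) * twoPt Δ (x 3) (x 4) +
  twoPt Δ (x 0) (x 5) * twoPt Δ (x 1) (x 3) * twoPt Δ (x 2) (x 4) +
  twoPt Δ (x 0) (x 5) * twoPt Δ (x 1) (x 4) * twoPt Δ (x 2) (x 3)

/-- `∑ᵢ ∑ⱼ ‖xᵢ - xⱼ‖²` over ordered pairs of a six-point configuration. [folklore] -/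
def sqSum6 (x : Fin 6 → EuclideanSpace ℝ (Fin 3)) : ℝ := ∑ i, ∑ j, ‖x i - x j‖ ^ 2

/-- The non-covariant six-point connected perturbation `(∑ᵢⱼ‖xᵢ−xⱼ‖²)^{-3Δ}`. [folklore] -/
def bump6 (Δ : ℝ) (x : Fin 6 → EuclideanSpace ℝ (Fin 3)) : ℝ := sqSum6 x ^ (-(3 * Δ))

/-- The six-point Wick sum IS inversion covariant (each pairing term is). [folklore] -/
theorem wick6_inversion (Δ : ℝ) {x : Fin 6 → EuclideanSpace ℝ (Fin 3)} (hx : ∀ i, x i ≠ 0) :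
    wick6 Δ (fun i => inversion 0 1 (x i)) = (∏ i, ‖x i‖ ^ (2 * Δ)) * wick6 Δ x := by
  simp only [wick6, twoPt_inversion Δ (hx _) (hx _), Fin.prod_univ_six]; ring

/-- The six-point Wick sum scales as `c^{-6Δ}`. [folklore] -/
theorem wick6_smul (Δ : ℝ) {c : ℝ} (hc : 0 < c) (x : Fin 6 → EuclideanSpace ℝ (Fin 3)) :
    wick6 Δ (fun i => c • x i) = c ^ (-(2 * Δ)) * c ^ (-(2 * Δ)) * c ^ (-(2 * Δ)) * wick6 Δ x := by
  simp only [wick6, twoPt_smul Δ hc]; ring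

/-- The six-point Wick sum is translation invariant. [folklore] -/
theorem wick6_add (Δ : ℝ) (v : EuclideanSpace ℝ (Fin 3)) (x : Fin 6 → EuclideanSpace ℝ (Fin 3)) :
    wick6 Δ (fun i => x i + v) = wick6 Δ x := by
  simp only [wick6, twoPt_add]

/-- The six-point Wick sum is `O(3)` invariant. [folklore] -/
theorem wick6_map (Δ : ℝ) (R : EuclideanSpace ℝ (Fin 3) ≃ₗᵢ[ℝ] EuclideanSpace ℝ (Fin 3))
    (x : Fin 6 → EuclideanSpace ℝ (Fin 3)) : wick6 Δ (fun i => R (x i)) = wick6 Δ x := by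
  simp only [wick6, twoPt_map]

/-- `sqSum6 ≥ 0`. [folklore] -/
theorem sqSum6_nonneg (x : Fin 6 → EuclideanSpace ℝ (Fin 3)) : 0 ≤ sqSum6 x :=
  Finset.sum_nonneg fun _ _ => Finset.sum_nonneg fun _ _ => sq_nonneg _

/-- `sqSum6` is translation invariant. [folklore] -/
theorem sqSum6_add (v : EuclideanSpace ℝ (Fin 3)) (x : Fin 6 → EuclideanSpace ℝ (Fin 3)) :
    sqSum6 (fun i => x i + v) = sqSum6 x := by simp [sqSum6]

/-- `sqSum6` is `O(3)` invariant. [folklore] -/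
theorem sqSum6_map (R : EuclideanSpace ℝ (Fin 3) ≃ₗᵢ[ℝ] EuclideanSpace ℝ (Fin 3))
    (x : Fin 6 → EuclideanSpace ℝ (Fin 3)) : sqSum6 (fun i => R (x i)) = sqSum6 x := by
  simp [sqSum6, ← map_sub]

/-- `sqSum6` is homogeneous of degree `2`. [folklore] -/
theorem sqSum6_smul {c : ℝ} (hc : 0 < c) (x : Fin 6 → EuclideanSpace ℝ (Fin 3)) :
    sqSum6 (fun i => c • x i) = c ^ 2 * sqSum6 x := by
  simp only [sqSum6, ← smul_sub, norm_smul, Real.norm_eq_abs, abs_of_pos hc, mul_pow, Finset.mul_sum]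

/-- `bump6` scales as `c^{-6Δ}`. [folklore] -/
theorem bump6_smul (Δ : ℝ) {c : ℝ} (hc : 0 < c) (x : Fin 6 → EuclideanSpace ℝ (Fin 3)) :
    bump6 Δ (fun i => c • x i) = c ^ (-(2 * Δ)) * c ^ (-(2 * Δ)) * c ^ (-(2 * Δ)) * bump6 Δ x := by
  rw [bump6, bump6, sqSum6_smul hc, Real.mul_rpow (by positivity) (sqSum6_nonneg x),
    ← Real.rpow_natCast c 2, ← Real.rpow_mul hc.le]
  rw [← Real.rpow_add hc, ← Real.rpow_add hc]
  push_cast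
  ring_nf

/-! ## The witness family -/

open Classical in
/-- The six-point witness: `S₀ = 1`, `S₂ = twoPt`, `S₄ = wick − harm` (CONFORMALLY COVARIANT,
`U₄ = -harm < 0`), `S₆ = wick6 − bump6` (NOT covariant), `0` otherwise and on coincident
configurations. [folklore] -/
def sixFamily (Δ : ℝ) : CorrFamily 3 := fun n =>
  match n with
  | 0 => fun _ => 1
  | 2 => fun x => twoPt Δ (x 0) (x 1)
  | 4 => fun x => if Function.Injective x then wick Δ x - harm Δ x else 0
  | 6 => fun x => if Function.Injective x then wick6 Δ x - bump6 Δ x else 0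
  | _ => fun _ => 0

/-- Unfolding, `n = 2`. [folklore] -/
theorem sixFamily_two (Δ : ℝ) (x : Fin 2 → EuclideanSpace ℝ (Fin 3)) :
    sixFamily Δ 2 x = twoPt Δ (x 0) (x 1) := rfl

open Classical in
/-- Unfolding, `n = 4`. [folklore] -/
theorem sixFamily_four (Δ : ℝ) (x : Fin 4 → EuclideanSpace ℝ (Fin 3)) :
    sixFamily Δ 4 x = if Function.Injective x then wick Δ x - harm Δ x else 0 := rfl

open Classical in
/-- Unfolding, `n = 6`. [folklore] -/
theorem sixFamily_six (Δ : ℝ) (x : Fin 6 → EuclideanSpace ℝ (Fin 3)) :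
    sixFamily Δ 6 x = if Function.Injective x then wick6 Δ x - bump6 Δ x else 0 := rfl

/-- Normalisation off `NonCoincident` (`Δ ≠ 0`). [folklore] -/
theorem sixFamily_eq_zero_of_not_mem {Δ : ℝ} (hΔ : Δ ≠ 0) (n : ℕ)
    (x : Fin n → EuclideanSpace ℝ (Fin 3)) (hx : x ∉ NonCoincident 3 n) : sixFamily Δ n x = 0 := by
  rw [mem_nonCoincident] at hx
  match n, x, hx with
  | 0, x, hx => exact absurd (Function.injective_of_subsingleton x) hx
  | 1, _, _ => rfl
  | 2, x, hx =>
    rw [sixFamily_two]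
    have h01 : x 0 = x 1 := by
      by_contra h
      exact hx ((injective_fin_two_iff x).2 h)
    rw [h01]
    exact twoPt_self hΔ _
  | 3, _, _ => rfl
  | 4, x, hx => rw [sixFamily_four, if_neg hx]
  | 5, _, _ => rfl
  | 6, x, hx => rw [sixFamily_six, if_neg hx]
  | (n + 7), _, _ => rfl

/-- Non-degenerate two-point function. [folklore] -/
theorem sixFamily_isNondegenerateTwoPoint (Δ : ℝ) : IsNondegenerateTwoPoint (sixFamily Δ) := by
  intro x hx
  rw [sixFamily_two]
  exact twoPt_pos Δ ((mem_nonCoincident x |>.1 hx).ne (by decide))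

/-- Translation invariance. [folklore] -/
theorem sixFamily_isTranslationInvariant (Δ : ℝ) : IsTranslationInvariant (sixFamily Δ) := by
  intro n v x
  match n, x with
  | 0, _ => rfl
  | 1, _ => rfl
  | 2, x => simp [sixFamily_two, twoPt_add]
  | 3, _ => rfl
  | 4, x =>
    simp only [sixFamily_four, injective_comp_iff (add_left_injective v) x, wick, twoPt_add, harm_add]
  | 5, _ => rfl
  | 6, x =>
    simp only [sixFamily_six, injective_comp_iff (add_left_injective v) x, wick6_add, bump6, sqSum6_add]
  | (n + 7), _ => rfl

/-- `O(3)` invariance. [folklore] -/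
theorem sixFamily_isRotationInvariant (Δ : ℝ) : IsRotationInvariant (sixFamily Δ) := by
  intro n R x
  match n, x with
  | 0, _ => rfl
  | 1, _ => rfl
  | 2, x => simp [sixFamily_two, twoPt_map]
  | 3, _ => rfl
  | 4, x =>
    simp only [sixFamily_four, injective_comp_iff R.injective x, wick, twoPt_map, harm_map]
  | 5, _ => rfl
  | 6, x =>
    simp only [sixFamily_six, injective_comp_iff R.injective x, wick6_map, bump6, sqSum6_map]
  | (n + 7), _ => rfl

/-- Euclidean invariance. [folklore] -/
theorem sixFamily_isEuclideanInvariant (Δ : ℝ) : IsEuclideanInvariant (sixFamily Δ) :=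
  ⟨sixFamily_isTranslationInvariant Δ, sixFamily_isRotationInvariant Δ⟩

/-- Scale covariance with dimension `Δ`. [folklore] -/
theorem sixFamily_isScaleCovariant (Δ : ℝ) : IsScaleCovariant Δ (sixFamily Δ) := by
  intro n c hc x
  match n, x with
  | 0, _ => simp [sixFamily]
  | 1, _ => simp [sixFamily]
  | 2, x =>
    have h1 : (-((2 : ℕ) : ℝ) * Δ) = -(2 * Δ) := by push_cast; ring
    rw [sixFamily_two, sixFamily_two, h1]
    exact twoPt_smul Δ hc _ _
  | 3, _ => simp [sixFamily]
  | 4, x =>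
    have hinj := injective_comp_iff (smul_right_injective _ hc.ne') x
    by_cases hx : Function.Injective x
    · rw [sixFamily_four, sixFamily_four, if_pos (hinj.2 hx), if_pos hx, wick_smul Δ hc, harm_smul Δ hc hx]
      have h1 : (-((4 : ℕ) : ℝ) * Δ) = -(2 * Δ) + -(2 * Δ) := by push_cast; ring
      rw [h1, Real.rpow_add hc]
      ring
    · rw [sixFamily_four, sixFamily_four, if_neg (mt hinj.1 hx), if_neg hx, mul_zero]
  | 5, _ => simp [sixFamily]
  | 6, x =>
    have hinj := injective_comp_iff (smul_right_injective _ hc.ne') x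
    by_cases hx : Function.Injective x
    · rw [sixFamily_six, sixFamily_six, if_pos (hinj.2 hx), if_pos hx, wick6_smul Δ hc, bump6_smul Δ hc]
      have h1 : (-((6 : ℕ) : ℝ) * Δ) = -(2 * Δ) + -(2 * Δ) + -(2 * Δ) := by push_cast; ring
      rw [h1, Real.rpow_add hc, Real.rpow_add hc]
      ring
    · rw [sixFamily_six, sixFamily_six, if_neg (mt hinj.1 hx), if_neg hx, mul_zero]
  | (n + 7), _ => simp [sixFamily]

/-- `U₄ = -harm` on non-coincident configurations. [folklore] -/
theorem limitConnectedFour_sixFamily (Δ : ℝ) {x : Fin 4 → EuclideanSpace ℝ (Fin 3)}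
    (hx : Function.Injective x) : limitConnectedFour (sixFamily Δ) x = -harm Δ x := by
  simp only [limitConnectedFour, sixFamily_four, if_pos hx, sixFamily_two, wick, harm, W1, W2, W3,
    Matrix.cons_val_zero, Matrix.cons_val_one]
  ring

/-- `U₄ = -wick` on coincident configurations (normalisation). [folklore] -/
theorem limitConnectedFour_sixFamily_of_not_injective (Δ : ℝ)
    {x : Fin 4 → EuclideanSpace ℝ (Fin 3)} (hx : ¬ Function.Injective x) :
    limitConnectedFour (sixFamily Δ) x = -wick Δ x := by
  simp only [limitConnectedFour, sixFamily_four, if_neg hx, sixFamily_two, wick,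
    Matrix.cons_val_zero, Matrix.cons_val_one]
  ring

/-- Lebowitz shape: `U₄ ≤ 0` everywhere. [folklore] -/
theorem limitConnectedFour_sixFamily_nonpos (Δ : ℝ) (x : Fin 4 → EuclideanSpace ℝ (Fin 3)) :
    limitConnectedFour (sixFamily Δ) x ≤ 0 := by
  by_cases hx : Function.Injective x
  · rw [limitConnectedFour_sixFamily Δ hx, neg_nonpos]; exact (harm_pos Δ hx).le
  · rw [limitConnectedFour_sixFamily_of_not_injective Δ hx, neg_nonpos]; exact wick_nonneg Δ x

/-- `U₄ ≢ 0` (indeed `U₄ < 0` on non-coincident configurations): the witness is NOT Gaussian at four points. [folklore] -/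
theorem sixFamily_hasNontrivialU4 (Δ : ℝ) : HasNontrivialU4 (sixFamily Δ) :=
  ⟨configInv, configInv_injective, by
    rw [limitConnectedFour_sixFamily Δ configInv_injective, neg_ne_zero]
    exact (harm_pos Δ configInv_injective).ne'⟩

/-- The six-point axis configuration `(e, 2e, …, 6e)`. [folklore] -/
def config6 : Fin 6 → EuclideanSpace ℝ (Fin 3) := fun i => axisPt (((i : ℕ) : ℝ) + 1)

/-- `(e, 2e, …, 6e)` is non-coincident. [folklore] -/
theorem config6_injective : Function.Injective config6 := by
  intro i j hij
  have h := axisPt_injective hij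
  exact Fin.ext (Nat.cast_injective (R := ℝ) (by linarith))

/-- `(e, 2e, …, 6e)` avoids the origin. [folklore] -/
theorem config6_ne_zero (i : Fin 6) : config6 i ≠ 0 :=
  axisPt_ne_zero (by positivity)

/-- The inverted configuration is `(e, e/2, …, e/6)`. [folklore] -/
theorem inversion_config6 (i : Fin 6) : inversion 0 1 (config6 i) = axisPt ((((i : ℕ) : ℝ) + 1)⁻¹) :=
  inversion_axisPt (by positivity)

end Summit.CriticalPhenomena.Ising3DConformalLimit.InversionUpgradeNormalisedNegative

end
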